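import Literature.Analysis.FluidPDE.SelfSimilarEulerVorticityExteriorEstimateLarge
import HarnessLib

/-!
# Self-similar Euler profiles: `L^p` vorticity with tame transport has compact support

Analysis/FluidPDE proofs file (theorems only; no definitions, no named facts) on the discharge path
of the named fact `Literature.Analysis.FluidPDE.chaeShvydkoy2013_vorticity_exclusion`
(Chae–Shvydkoy, ARMA 209 (2013) = arXiv:1201.6009, Thm 4.1). It performs the limit `L_j → ∞`,
`ε → 0` in the level inequalities of `SelfSimilarEulerVorticityExteriorEstimate(Large).lean`
(regularised powers `G_ε` for `a ≤ 1`, the power `|Ω|^{2a}` itself for `a ≥ 1`) and concludes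
the FIRST half of the printed proof of Thm 4.1 ("Consequently `∫_{|y|>R} |ω|^p dy = 0` … and
hence `ω = 0` on `{y ∈ ℝ³ | |y| > R}`"):

* `IsSelfSimilarEulerVorticityProfile.hasCompactSupport_curl_of_integrable_rpow` — for a
  vorticity-form profile (`U ∈ C²`, `div U = 0`, `Ω + (V·∇)Ω = (Ω·∇)U`, `V = γ(y−c) + U`) with
  `|Ω|^{2a} ∈ L¹` for some `0 < a` with `2a < 3γ` (i.e. `ω ∈ L^p`, `p = 2a < 3/(1+α)` in CS13's
  variables), eventually outward radial transport of quadratic growth and eventually small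
  stretching `|⟪Ω, DU Ω⟫| ≤ η|Ω|²`, the vorticity `Ω = curl U` has compact support;
* `IsSelfSimilarEulerVorticityProfile.curl_eq_zero_of_integrable_rpow` — hence (by
  `curl_eq_zero_of_hasCompactSupport`, the second half) `Ω ≡ 0` when moreover `γ > 0`.

The hypotheses on `V` and on the stretching are exactly what the strain condition (i) of Thm 4.1
(`½(DU + DUᵀ) → 0` at infinity) supplies; that derivation and the final "irrotational +
incompressible + `DU → 0` ⇒ constant" step are in `SelfSimilarEulerVorticityExclusionHolds.lean`.

## Proof

With `M = sup |smoothTransition'|`, `η = (3γ − 2a)/(4a)` (so `2a(1+η) < 3γ`), `R ≥ R₀, R₁`, the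
level inequality at `ε = 1/(j+1)`, `L = j+1` reads
`3γ ∫ G_j φ τ_j ≤ 2a(1+η) ∫ φ |Ω|^{2a} + 5MC ∫ 𝟙_{|y−c| ≥ j+1} |Ω|^{2a}`; by dominated convergence
(`0 ≤ G_j φ τ_j ≤ |Ω|^{2a} ∈ L¹`, `G_j → |Ω|^{2a}`, `τ_j → 1`, `𝟙_{|y−c|≥j+1} → 0`) the limit is
`3γ ∫ φ|Ω|^{2a} ≤ 2a(1+η) ∫ φ|Ω|^{2a}`, so `∫ φ |Ω|^{2a} = 0`, `φ |Ω|^{2a} ≡ 0` by continuity, and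
`Ω = 0` where `φ = 1`, i.e. off `B(c, 2R)`.

## References

* D. Chae, R. Shvydkoy, ARMA 209 (2013) = arXiv:1201.6009, §4, proof of Thm 4.1.
  [ChaeShvydkoy2013]
-/

noncomputable section

open MeasureTheory Set Filter Function Topology InnerProductSpace Metric
open scoped RealInnerProductSpace NNReal

namespace Literature.Analysis.FluidPDE

namespace IsSelfSimilarEulerVorticityProfile

variable {γ : ℝ} {c : EuclideanSpace ℝ (Fin 3)}
  {U : EuclideanSpace ℝ (Fin 3) → EuclideanSpace ℝ (Fin 3)}

/-- **`L^p` vorticity with tame transport is compactly supported** (first half of the proof of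
CS13 Thm 4.1, smooth-weight version). Hypotheses: a vorticity-form profile; `0 < a` with
`2a < 3γ` and `|Ω|^{2a} ∈ L¹(ℝ³)`; the radial transport `⟪V(y), y − c⟫` (`V = γ(y−c) + U`) is
`≥ 0` for `|y − c| ≥ R₀` and `O(1 + |y − c|²)`; for every `η > 0` the stretching obeys
`|⟪Ω, DU Ω⟫| ≤ η |Ω|²` outside some ball. Then `curl U` has compact support. [cite: ChaeShvydkoy2013, §4 Thm 4.1 (proof, exterior part)] -/
theorem hasCompactSupport_curl_of_integrable_rpow (h : IsSelfSimilarEulerVorticityProfile γ c U)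
    {a : ℝ} (ha : 0 < a) (haγ : 2 * a < 3 * γ)
    (hint : Integrable (fun y => (‖curl U y‖ ^ 2) ^ a))
    (hout : ∃ R₀ : ℝ, 0 < R₀ ∧ ∀ y, R₀ ≤ ‖y - c‖ → 0 ≤ ⟪selfSimilarTransport γ c U y, y - c⟫)
    (hgrowth : ∃ C : ℝ, ∀ y, |⟪selfSimilarTransport γ c U y, y - c⟫| ≤ C * (1 + ‖y - c‖ ^ 2))
    (hstretch : ∀ η : ℝ, 0 < η → ∃ R₁ : ℝ, ∀ y, R₁ ≤ ‖y - c‖ →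
      |⟪curl U y, fderiv ℝ U y (curl U y)⟫| ≤ η * ‖curl U y‖ ^ 2) :
    HasCompactSupport (curl U) := by
  set Ω : EuclideanSpace ℝ (Fin 3) → EuclideanSpace ℝ (Fin 3) := curl U with hΩdef
  set fa : EuclideanSpace ℝ (Fin 3) → ℝ := fun y => (‖Ω y‖ ^ 2) ^ a with hfadef
  have hγ : 0 < γ := by linarith
  -- constants
  obtain ⟨M, hM0, hM⟩ := exists_abs_deriv_smoothTransition_le
  set η : ℝ := (3 * γ - 2 * a) / (4 * a) with hηdef
  have hη : 0 < η := div_pos (by linarith) (by linarith)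
  have hcoef : 2 * a * (1 + η) < 3 * γ := by
    have e : 2 * a * (1 + η) = 2 * a + (3 * γ - 2 * a) / 2 := by
      rw [hηdef]; field_simp; ring
    rw [e]; linarith
  obtain ⟨R₀, hR₀, hout⟩ := hout
  obtain ⟨C, hgrowth⟩ := hgrowth
  obtain ⟨R₁, hstretch⟩ := hstretch η hη
  set R : ℝ := max R₀ R₁ with hRdef
  have hR₀R : R₀ ≤ R := le_max_left _ _
  have hRpos : 0 < R := hR₀.trans_le hR₀R
  have hstretchR : ∀ y, R ≤ ‖y - c‖ → |⟪Ω y, fderiv ℝ U y (Ω y)⟫| ≤ η * ‖Ω y‖ ^ 2 :=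
    fun y hy => hstretch y ((le_max_right _ _).trans hy)
  have hC0 : 0 ≤ C := by
    have h1 := hgrowth c
    simp only [sub_self, inner_zero_right, abs_zero, norm_zero] at h1
    linarith
  -- regularity and pointwise facts
  have hU2 : ContDiff ℝ 2 U := h.contDiff_velocity
  have hΩ1 : ContDiff ℝ 1 Ω := contDiff_curl (n := 1) (by exact_mod_cast hU2)
  have hΩc : Continuous Ω := hΩ1.continuous
  have hfa_cont : Continuous fa := (hΩc.norm.pow 2).rpow_const fun _ => Or.inr ha.le
  have hfa_nn : ∀ y, 0 ≤ fa y := fun y => Real.rpow_nonneg (sq_nonneg _) _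
  set φ : EuclideanSpace ℝ (Fin 3) → ℝ := fun z => 1 - taoCutoff (2 * R) R (z - c) with hφdef
  have hφ_mem : ∀ z, φ z ∈ Icc (0 : ℝ) 1 := fun z => by
    have hm := taoCutoff_comp_sub_mem_Icc R c z
    exact ⟨by simp only [hφdef]; linarith [hm.2], by simp only [hφdef]; linarith [hm.1]⟩
  have hφc : Continuous φ := continuous_const.sub (contDiff_taoCutoff_comp_sub (2 * R) R c
    (n := 0)).continuous
  have hφ_one : ∀ z, 2 * R ≤ ‖z - c‖ → φ z = 1 := fun z hz => by
    simp only [hφdef, taoCutoff_comp_sub_eq_zero hRpos.le hz, sub_zero]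
  -- the cutoffs `τ_j = θ_{2(j+1), j+1}(· − c)` and the tails `𝟙_{|y−c| ≥ j+1} |Ω|^{2a}`
  set τn : ℕ → EuclideanSpace ℝ (Fin 3) → ℝ := fun n y =>
    taoCutoff (2 * ((n : ℝ) + 1)) ((n : ℝ) + 1) (y - c) with hτndef
  set Tn : ℕ → EuclideanSpace ℝ (Fin 3) → ℝ := fun n y =>
    Set.indicator {y | ((n : ℝ) + 1) ≤ ‖y - c‖} fa y with hTndef
  have hεn : ∀ n : ℕ, (0 : ℝ) < 1 / ((n : ℝ) + 1) := fun n => by positivity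
  have hLn : ∀ n : ℕ, (1 : ℝ) ≤ (n : ℝ) + 1 := fun n => by
    have : (0 : ℝ) ≤ n := Nat.cast_nonneg n
    linarith
  have hI1 : Integrable (fun y => φ y * fa y) := by
    refine Integrable.mono' hint (hφc.aestronglyMeasurable.mul hfa_cont.aestronglyMeasurable)
      (ae_of_all _ fun y => ?_)
    rw [Real.norm_eq_abs, abs_mul, abs_of_nonneg (hφ_mem y).1, abs_of_nonneg (hfa_nn y)]
    exact mul_le_of_le_one_left (hfa_nn y) (hφ_mem y).2
  -- the level sequence `H_j`: `G_{1/(j+1)}` (regularised) when `a ≤ 1`, `|Ω|^{2a}` itself when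
  -- `a > 1`; in both cases `0 ≤ H_j ≤ |Ω|^{2a}`, `H_j → |Ω|^{2a}` and the level inequality holds
  have hlevel_all : ∃ Hn : ℕ → EuclideanSpace ℝ (Fin 3) → ℝ, (∀ n, Continuous (Hn n)) ∧
      (∀ n y, Hn n y ∈ Icc 0 (fa y)) ∧ (∀ y, Tendsto (fun n => Hn n y) atTop (𝓝 (fa y))) ∧
      ∀ n : ℕ, 3 * γ * ∫ y, Hn n y * (φ y * τn n y) ≤
        (2 * a * (1 + η) * ∫ y, φ y * fa y) + 5 * M * C * ∫ y, Tn n y := by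
    by_cases ha1 : a ≤ 1
    · refine ⟨fun n y => (‖Ω y‖ ^ 2 + 1 / ((n : ℝ) + 1)) ^ a - (1 / ((n : ℝ) + 1)) ^ a,
        fun n => (contDiff_rpow_norm_sq_add hΩ1 (hεn n) a).continuous,
        fun n y => rpow_add_sub_rpow_mem_Icc (sq_nonneg ‖Ω y‖) (hεn n) ha.le ha1,
        fun y => tendsto_rpow_add_sub_rpow (‖Ω y‖ ^ 2) ha, fun n => ?_⟩
      exact h.integral_rpow_norm_sq_curl_weight_le ha ha1 (hεn n) hM hR₀ hR₀R (hLn n) hη.le hout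
        hgrowth hstretchR hint
    · have ha1' : 1 ≤ a := (not_le.1 ha1).le
      refine ⟨fun _ => fa, fun _ => hfa_cont, fun n y => ⟨hfa_nn y, le_rfl⟩,
        fun y => tendsto_const_nhds, fun n => ?_⟩
      exact h.integral_rpow_norm_sq_curl_weight_le_of_one_le ha1' hM hR₀ hR₀R (hLn n) hη.le hout
        hgrowth hstretchR hint
  obtain ⟨Hn, hHc, hHmem, hHlim, hlevel⟩ := hlevel_all
  -- dominated convergence for the left-hand side: `∫ H_j φ τ_j → ∫ φ |Ω|^{2a}`
  have hτn_mem : ∀ n y, τn n y ∈ Icc (0 : ℝ) 1 := fun n y => taoCutoff_comp_sub_mem_Icc _ c y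
  have hlimL : Tendsto (fun n => ∫ y, Hn n y * (φ y * τn n y)) atTop (𝓝 (∫ y, φ y * fa y)) := by
    refine tendsto_integral_of_dominated_convergence fa (fun n => ?_) hint (fun n => ?_) ?_
    · have hc2 : Continuous (τn n) :=
        (contDiff_taoCutoff_comp_sub (2 * ((n : ℝ) + 1)) ((n : ℝ) + 1) c (n := 0)).continuous
      exact ((hHc n).mul (hφc.mul hc2)).aestronglyMeasurable
    · refine ae_of_all _ fun y => ?_
      have h1 := hHmem n y
      have h2 : φ y * τn n y ∈ Icc (0 : ℝ) 1 :=
        ⟨mul_nonneg (hφ_mem y).1 (hτn_mem n y).1,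
          mul_le_one₀ (hφ_mem y).2 (hτn_mem n y).1 (hτn_mem n y).2⟩
      rw [Real.norm_eq_abs, abs_of_nonneg (mul_nonneg h1.1 h2.1)]
      calc Hn n y * (φ y * τn n y) ≤ fa y * 1 := mul_le_mul h1.2 h2.2 h2.1 (hfa_nn y)
        _ = fa y := mul_one _
    · refine ae_of_all _ fun y => ?_
      -- `τ_j(y) = 1` eventually, and `H_j(y) → |Ω(y)|^{2a}`
      have hτ_ev : ∀ᶠ n : ℕ in atTop, τn n y = 1 := by
        obtain ⟨N, hN⟩ := exists_nat_ge ‖y - c‖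
        refine Filter.eventually_atTop.2 ⟨N, fun n hn => ?_⟩
        have hn' : (N : ℝ) ≤ n := Nat.cast_le.2 hn
        exact taoCutoff_comp_sub_eq_one (by linarith) (by linarith)
      have hprod : Tendsto (fun n => Hn n y * (φ y * 1)) atTop (𝓝 (fa y * (φ y * 1))) :=
        (hHlim y).mul tendsto_const_nhds
      rw [mul_one, mul_comm (fa y)] at hprod
      refine hprod.congr' ?_
      filter_upwards [hτ_ev] with n hn
      rw [hn, mul_one]
  -- dominated convergence for the tail: `∫ 𝟙_{|y−c| ≥ j+1} |Ω|^{2a} → 0`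
  have hmeas : ∀ n : ℕ, MeasurableSet {y : EuclideanSpace ℝ (Fin 3) | ((n : ℝ) + 1) ≤ ‖y - c‖} :=
    fun n => (isClosed_le continuous_const (continuous_id.sub continuous_const).norm).measurableSet
  have hlimT : Tendsto (fun n => ∫ y, Tn n y) atTop (𝓝 (∫ _ : EuclideanSpace ℝ (Fin 3), (0 : ℝ))) := by
    refine tendsto_integral_of_dominated_convergence fa (fun n => ?_) hint (fun n => ?_) ?_
    · exact (hint.indicator (hmeas n)).aestronglyMeasurable
    · refine ae_of_all _ fun y => ?_
      rw [hTndef]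
      simp only
      rw [Real.norm_eq_abs]
      by_cases hy : y ∈ {y : EuclideanSpace ℝ (Fin 3) | ((n : ℝ) + 1) ≤ ‖y - c‖}
      · rw [Set.indicator_of_mem hy, abs_of_nonneg (hfa_nn y)]
      · rw [Set.indicator_of_notMem hy, abs_zero]
        exact hfa_nn y
    · refine ae_of_all _ fun y => ?_
      obtain ⟨N, hN⟩ := exists_nat_ge ‖y - c‖
      refine tendsto_const_nhds.congr' ?_
      refine Filter.eventually_atTop.2 ⟨N, fun n hn => ?_⟩
      have hn' : (N : ℝ) ≤ n := Nat.cast_le.2 hn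
      have hnot : y ∉ {y : EuclideanSpace ℝ (Fin 3) | ((n : ℝ) + 1) ≤ ‖y - c‖} := fun hmem => by
        simp only [mem_setOf_eq] at hmem
        linarith
      simp only [hTndef, Set.indicator_of_notMem hnot]
  rw [integral_zero] at hlimT
  -- pass to the limit in the level inequality
  have hlimR : Tendsto (fun n => (2 * a * (1 + η) * ∫ y, φ y * fa y) + 5 * M * C * ∫ y, Tn n y)
      atTop (𝓝 ((2 * a * (1 + η) * ∫ y, φ y * fa y) + 5 * M * C * 0)) :=
    tendsto_const_nhds.add (hlimT.const_mul _)
  rw [mul_zero, add_zero] at hlimR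
  have hIle : 3 * γ * ∫ y, φ y * fa y ≤ 2 * a * (1 + η) * ∫ y, φ y * fa y :=
    le_of_tendsto_of_tendsto (hlimL.const_mul (3 * γ)) hlimR (Eventually.of_forall hlevel)
  -- hence `∫ φ |Ω|^{2a} = 0`
  have hInn : 0 ≤ ∫ y, φ y * fa y := integral_nonneg fun y => mul_nonneg (hφ_mem y).1 (hfa_nn y)
  have hI0 : ∫ y, φ y * fa y = 0 := by
    by_contra hne
    have hIpos : 0 < ∫ y, φ y * fa y := lt_of_le_of_ne hInn (Ne.symm hne)
    nlinarith
  have hae : (fun y => φ y * fa y) =ᵐ[volume] 0 :=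
    (integral_eq_zero_iff_of_nonneg (fun y => mul_nonneg (hφ_mem y).1 (hfa_nn y)) hI1).1 hI0
  have h0 : (fun y => φ y * fa y) = 0 := ((hφc.mul hfa_cont).ae_eq_iff_eq volume continuous_zero).1 hae
  -- so `Ω = 0` off `B(c, 2R)`
  refine HasCompactSupport.of_support_subset_isCompact (isCompact_closedBall c (2 * R))
    fun y hy => ?_
  rw [mem_closedBall, dist_eq_norm]
  by_contra hcon
  have hyR : 2 * R ≤ ‖y - c‖ := (not_le.1 hcon).le
  have hprod : φ y * fa y = 0 := congrFun h0 y
  rw [hφ_one y hyR, one_mul] at hprod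
  have hsq : ‖Ω y‖ ^ 2 = 0 := by
    rcases (Real.rpow_eq_zero (sq_nonneg _) ha.ne').1 hprod with h0'
    exact h0'
  have : Ω y = 0 := by
    rw [← norm_eq_zero]
    exact pow_eq_zero_iff (n := 2) (by norm_num) |>.1 hsq
  exact hy this

/-- **`L^p` vorticity with tame transport vanishes identically** (both halves of the proof of
CS13 Thm 4.1 for vorticity-form profiles with `γ > 0`): under the hypotheses of
`hasCompactSupport_curl_of_integrable_rpow`, `curl U = 0`. [cite: ChaeShvydkoy2013, §4 Thm 4.1 (proof)] -/
theorem curl_eq_zero_of_integrable_rpow (h : IsSelfSimilarEulerVorticityProfile γ c U)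
    {a : ℝ} (ha : 0 < a) (haγ : 2 * a < 3 * γ)
    (hint : Integrable (fun y => (‖curl U y‖ ^ 2) ^ a))
    (hout : ∃ R₀ : ℝ, 0 < R₀ ∧ ∀ y, R₀ ≤ ‖y - c‖ → 0 ≤ ⟪selfSimilarTransport γ c U y, y - c⟫)
    (hgrowth : ∃ C : ℝ, ∀ y, |⟪selfSimilarTransport γ c U y, y - c⟫| ≤ C * (1 + ‖y - c‖ ^ 2))
    (hstretch : ∀ η : ℝ, 0 < η → ∃ R₁ : ℝ, ∀ y, R₁ ≤ ‖y - c‖ →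
      |⟪curl U y, fderiv ℝ U y (curl U y)⟫| ≤ η * ‖curl U y‖ ^ 2) :
    curl U = 0 :=
  h.curl_eq_zero_of_hasCompactSupport (by linarith)
    (h.hasCompactSupport_curl_of_integrable_rpow ha haγ hint hout hgrowth hstretch)

end IsSelfSimilarEulerVorticityProfile

end Literature.Analysis.FluidPDE

end
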